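import Summits.FinalStateConjecture.FinalStateConjecture.Theses.PhotonSphereChannels
import Literature.Geometry.Lorentzian.ModelData
import Literature.Geometry.Lorentzian.ModelDataProofs
import Literature.Geometry.Lorentzian.ModelDataCompletenessProofs
import Literature.Geometry.Lorentzian.TrivialDataAdmissible

/-!
# `TameCensorship` (crux `stmt-FinalStateConjecture-10047`, route `PhotonSphereChannels`):
# read-back, non-vacuity of its domain and its existential content (negative-side support)

Support file of the crux disprover (cdisprove seat). Proved here, `sorry`-free:

* `tameCensorship_iff_tame` — the crux is, for every `Σ`, TAME Christodoulou-genericity (tame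
  codimension `≥ 1`, curve form on one fixed asymptotically flat end, immersed at the base point,
  relative to `admissibleVacuumData Σ`) of membership in the verbatim property `tameSet Σ` (MGHD exists;
  every MGHD has complete `𝓘⁺`, no extremal remnant, bounded outer geometry) — `Iff.rfl`;
  `not_tameCensorship_iff_tame` — the exact shape of a refutation; `isChristodoulouGeneric_of_tameCensorship`
  — the crux implies the topology-free genericity of the same property (the pre-re-type crux
  stmt-FinalStateConjecture-10047); `not_tameCensorship_of_smooth_witness` — hence a refutation in the OLD
  shape (an exceptional admissible datum all of whose smooth injective admissible curves meet the
  exceptional set again) still refutes the re-typed crux. The pre-re-type read-backs `tameCensorship_iff`,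
  `not_tameCensorship_iff` survive as deprecated aliases (see the maintenance record).
* `not_isChristodoulouGeneric_of_forall_not` / `exists_of_isChristodoulouGeneric` — transparency
  of curve-genericity on a nonempty admissible class.
* non-vacuity is the tree's `Literature.Geometry.Lorentzian.trivialData_mem_admissibleVacuumData`
  (`TrivialDataAdmissible.lean`: the Minkowski data `(ℝ³, δ, 0)` are admissible), imported: the
  crux is not vacuously true;
* `exists_isMaximal_of_tameCensorship` — `TameCensorship` implies the existence of an admissible
  datum on `ℝ³` with a MAXIMAL vacuum Cauchy development having complete future null infinity; no
  maximality / MGHD-existence theorem is in the tree, so this is existential content every proof of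
  the crux must supply.

Maintenance record (full-build repair, 2026-08-17; dependency drift). Route PhotonSphereChannels rev 15
(2026-08-16T23:19Z, after the T2 re-type of the summit statement p126844) RESTATED the crux under the same
decl name `TameCensorship` (stmt-FinalStateConjecture-10047 → stmt-FinalStateConjecture-17431): the same
bundled property is now TAME-Christodoulou-generic (`InitialDataSet.IsTameChristodoulouGeneric`: an AF end,
a tame immersed family). Consequently the read-back `tameCensorship_iff : TameCensorship ↔ (topology-free
genericity of tameSet)` is no longer `Iff.rfl` (83:2) — and no longer true as a biconditional (only `→`
survives, `IsTameChristodoulouGeneric.isChristodoulouGeneric`), and likewise `not_tameCensorship_iff` (only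
`←` survives). Append-only repair: the re-typed read-backs are added under new names
(`tameCensorship_iff_tame`, `not_tameCensorship_iff_tame`), the surviving directions as
`isChristodoulouGeneric_of_tameCensorship` / `not_tameCensorship_of_smooth_witness`, the old names become
deprecated aliases of the re-typed read-backs, and `exists_mem_tameSet_of_tameCensorship` keeps its statement
with the proof routed through the topology-free genericity. `tameSet`, §2 and
`exists_isMaximal_of_tameCensorship` are unchanged.
-/

noncomputable section

-- `Summit.<Summit>.<Problem>` is the mandated summit-side namespace (CONVENTIONS §2); for the
-- single-conjunct summit `FinalStateConjecture` the two coincide, so the duplicate is deliberate.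
set_option linter.dupNamespace false

open Bundle TopologicalSpace Manifold Set
open scoped ContDiff Topology

namespace Summit.FinalStateConjecture.FinalStateConjecture.Theorems.TameCensorship.Negative

open Literature.Geometry.Lorentzian
open Summit.FinalStateConjecture.FinalStateConjecture.Theses.PhotonSphereChannels (TameCensorship)

/-! ## §1 Read-back: the tame property as a set of data, and the crux unfolded -/

/-- The property bundled by `TameCensorship`, verbatim, as a set of initial data sets on `X`:
an MGHD exists, and every MGHD has complete `𝓘⁺` (sojourn form), no extremal-Kerr remnant (no late
chart from a boosted extremal Kerr exterior with truncated `C²` deviation `→ 0` for every `R`) and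
bounded `C³` geometry of the outer region `J⁺(Σ) ∩ ⋃ I⁻(future-complete normalised null rays)` at a
uniform coordinate scale `r₀` (`C⁰` deviation `≤ 1/2`, `C³` deviation `≤ Λ`). -/
def tameSet (X : Type) [TopologicalSpace X] [ChartedSpace E3 X]
    [IsManifold (modelWithCornersSelf ℝ E3) ((⊤ : ℕ∞) : WithTop ℕ∞) X] [ConnectedSpace X] :
    Set (InitialDataSet (modelWithCornersSelf ℝ E3) X) :=
  {D | (∃ 𝒟 : VacuumCauchyDevelopment D, 𝒟.IsMaximal) ∧
    ∀ 𝒟 : VacuumCauchyDevelopment D, 𝒟.IsMaximal →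
      _root_.Summit.FinalStateConjecture.HasCompleteNullInfinity 𝒟.toCauchyDevelopment ∧
      ((∀ (Λ : lorentzGroup) (c : E4) (M a : ℝ), Kerr.IsExtremal M a →
        ¬ ∃ (τ₀ : ℝ) (Ψ : (boostedKerrBackground Λ c M a).domain → 𝒟.carrier),
          𝒟.toSpacetime.IsLateChart (boostedKerrBackground Λ c M a) Set.univ τ₀ Ψ ∧
          ∀ R : ℝ, Filter.Tendsto
            (fun τ => 𝒟.toSpacetime.truncDeviationCk (boostedKerrBackground Λ c M a) Ψ 2 R τ)
            Filter.atTop (nhds 0)) ∧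
      ∀ [𝒟.metric.HasLeviCivita],
        let outer : Set 𝒟.carrier :=
          𝒟.metric.causalFuture 𝒟.timeOrientation (Set.range 𝒟.embed) ∩
            {q | ∃ (p : X) (γ : ℝ → 𝒟.carrier) (dom : Set ℝ),
              𝒟.metric.IsNormalisedNullRayFrom 𝒟.timeOrientation 𝒟.embed 𝒟.normal p γ dom ∧
              ¬ BddAbove dom ∧
              q ∈ 𝒟.metric.chronologicalPast 𝒟.timeOrientation (γ '' (dom ∩ Set.Ici 0))}
        ∃ r₀ : ℝ, 0 < r₀ ∧ ∃ Λ : NNReal, ∀ q ∈ outer,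
          let U : TopologicalSpace.Opens E4 := ⟨Metric.ball (0 : E4) r₀, Metric.isOpen_ball⟩
          ∃ Ψ : U → 𝒟.carrier,
            𝒟.toSpacetime.IsLateChart (Minkowski.backgroundOn U) Set.univ (-r₀) Ψ ∧
            (∃ x : U, (x : E4) = 0 ∧ Ψ x = q) ∧
            supCkENorm (U : Set E4) 3
              (𝒟.toSpacetime.deviationExtend (Minkowski.backgroundOn U) Ψ) ≤ (Λ : ENNReal) ∧
            supCkENorm (U : Set E4) 0
              (𝒟.toSpacetime.deviationExtend (Minkowski.backgroundOn U) Ψ) ≤ 1 / 2)}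

/-- **Read-back of the crux (rev 15, T2 re-type).** `TameCensorship` is, for every connected Hausdorff
second countable `3`-manifold `Σ`, TAME Christodoulou-genericity (tame codimension `≥ 1`: through every
exceptional admissible datum pass ONE asymptotically flat end and an injective one-parameter admissible
family tame on that end and immersed at the base point, relative to the admissible class) of membership in
`tameSet Σ`. By `Iff.rfl`: the statement is typed as intended (no coercion or junk operator intervenes
between the informal text and the `Prop`). -/
theorem tameCensorship_iff_tame :
    TameCensorship ↔ ∀ (X : Type) [TopologicalSpace X] [ChartedSpace E3 X]
      [IsManifold (modelWithCornersSelf ℝ E3) ((⊤ : ℕ∞) : WithTop ℕ∞) X] [T2Space X]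
      [SecondCountableTopology X] [ConnectedSpace X],
      InitialDataSet.IsTameChristodoulouGeneric (admissibleVacuumData X) (· ∈ tameSet X) 1 :=
  Iff.rfl

/-- **The crux implies the pre-re-type crux**: tame genericity of `tameSet Σ` gives its topology-free
Christodoulou-genericity (forget the end, tameness and immersion;
`IsTameChristodoulouGeneric.isChristodoulouGeneric`) — the statement of the retired stmt-10047, so every
negative-side lemma about the old form transfers to the re-typed crux by contraposition. -/
theorem isChristodoulouGeneric_of_tameCensorship (h : TameCensorship) (X : Type) [TopologicalSpace X]
    [ChartedSpace E3 X] [IsManifold (modelWithCornersSelf ℝ E3) ((⊤ : ℕ∞) : WithTop ℕ∞) X] [T2Space X]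
    [SecondCountableTopology X] [ConnectedSpace X] :
    InitialDataSet.IsChristodoulouGeneric (admissibleVacuumData X) (· ∈ tameSet X) 1 :=
  (tameCensorship_iff_tame.1 h X).isChristodoulouGeneric

/-- Pre-re-type read-back (landed 2026-08-15 as `Iff.rfl` against stmt-FinalStateConjecture-10047:
`TameCensorship ↔` topology-free genericity of `tameSet`). Since route rev 15 (T2 re-type, 2026-08-16) the
decl `TameCensorship` is TAME-generic, so that biconditional neither elaborates by `Iff.rfl` nor holds
(only `→` survives: `isChristodoulouGeneric_of_tameCensorship`); the name is kept (append-only) as an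
alias of the re-typed read-back `tameCensorship_iff_tame`. -/
@[deprecated tameCensorship_iff_tame (since := "2026-08-17")]
alias tameCensorship_iff := tameCensorship_iff_tame

/-! ## §2 Transparency of curve-genericity: what a proof and what a refutation must do -/

section Transparency

variable {E : Type*} [NormedAddCommGroup E] [NormedSpace ℝ E] {H : Type*} [TopologicalSpace H]
  {I : ModelWithCorners ℝ E H} {X : Type*} [TopologicalSpace X] [ChartedSpace H X]
  [IsManifold I ∞ X]

/-- A nonzero parameter exists in `ℝ¹`. -/
theorem euclideanSpace_one_exists_ne_zero : ∃ c : EuclideanSpace ℝ (Fin 1), c ≠ 0 :=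
  ⟨EuclideanSpace.single 0 1, fun h ↦ by simpa using congrArg (fun c : EuclideanSpace ℝ (Fin 1) ↦ c 0) h⟩

/-- **What a refutation amounts to.** If the property fails on ALL of a nonempty admissible class,
it is not Christodoulou-generic: every admissible curve through an exceptional datum consists of
exceptional data. (Dual of the tree's `isChristodoulouGeneric_of_forall`.) -/
theorem not_isChristodoulouGeneric_of_forall_not {𝓓 : Set (InitialDataSet I X)}
    {P : InitialDataSet I X → Prop} (hne : 𝓓.Nonempty) (hP : ∀ d ∈ 𝓓, ¬ P d) (m : ℕ)
    (hm : m ≠ 0) : ¬ InitialDataSet.IsChristodoulouGeneric 𝓓 P m := by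
  intro h
  obtain ⟨d, hd⟩ := hne
  obtain ⟨F, -, -, -, hadm, hexc⟩ := h d ⟨hd, hP d hd⟩
  have : ∃ c : EuclideanSpace ℝ (Fin m), c ≠ 0 := by
    obtain ⟨i⟩ : Nonempty (Fin m) := ⟨⟨0, Nat.pos_of_ne_zero hm⟩⟩
    exact ⟨EuclideanSpace.single i 1, fun h ↦ by
      simpa using congrArg (fun c : EuclideanSpace ℝ (Fin m) ↦ c i) h⟩
  obtain ⟨c, hc⟩ := this
  exact hexc c hc ⟨hadm c, hP _ (hadm c)⟩

/-- **What a proof yields at least.** A Christodoulou-generic property (codimension `m ≥ 1`) on a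
nonempty admissible class holds for SOME admissible datum. -/
theorem exists_of_isChristodoulouGeneric {𝓓 : Set (InitialDataSet I X)}
    {P : InitialDataSet I X → Prop} {m : ℕ} (hm : m ≠ 0)
    (h : InitialDataSet.IsChristodoulouGeneric 𝓓 P m) (hne : 𝓓.Nonempty) : ∃ d ∈ 𝓓, P d := by
  by_contra hno
  push Not at hno
  exact not_isChristodoulouGeneric_of_forall_not hne hno m hm h

end Transparency

/-- **The shape of `¬ TameCensorship`** (pure unfolding, rev 15): some `Σ` and some admissible
exceptional datum `D` on it such that for EVERY asymptotically flat end `e` of `Σ`, every injective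
admissible one-parameter family through `D` that is tame on `e` (jointly smooth, `e` the sole end,
Dafermos–Rodnianski asymptotics with continuous mass, weighted continuity at `c = 0`) and immersed at `0`
contains another exceptional member. Recorded for refuters: compared with the pre-re-type shape the
universal quantifier now ranges over the much smaller supply of TAME immersed curves — burial-type
families (exact Kerr outside a receding set, mass `→ ∞`) no longer have to be defeated. -/
theorem not_tameCensorship_iff_tame :
    ¬ TameCensorship ↔ ∃ (X : Type) (_ : TopologicalSpace X) (_ : ChartedSpace E3 X)
      (_ : IsManifold (modelWithCornersSelf ℝ E3) ((⊤ : ℕ∞) : WithTop ℕ∞) X) (_ : T2Space X)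
      (_ : SecondCountableTopology X) (_ : ConnectedSpace X),
      ∃ D ∈ admissibleVacuumData X, D ∉ tameSet X ∧
        ∀ (e : AFEnd X) (F : EuclideanSpace ℝ (Fin 1) → InitialDataSet (modelWithCornersSelf ℝ E3) X),
          InitialDataSet.IsTameDataFamily e 1 F → InitialDataSet.IsImmersedAtZero 1 F → F 0 = D →
          Function.Injective F → (∀ c, F c ∈ admissibleVacuumData X) →
          ∃ c ≠ 0, F c ∉ tameSet X := by
  rw [tameCensorship_iff_tame]
  constructor
  · intro h
    by_contra hcon
    apply h
    intro X _ _ _ _ _ _ D hD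
    by_contra hF
    apply hcon
    refine ⟨X, ‹_›, ‹_›, ‹_›, ‹_›, ‹_›, ‹_›, D, hD.1, hD.2, fun e F h1 h1' h2 h3 h4 ↦ ?_⟩
    by_contra hc
    push Not at hc
    exact hF ⟨e, F, h1, h1', h2, h3, h4, fun c hc0 hmem ↦ hmem.2 (hc c hc0)⟩
  · rintro ⟨X, _, _, _, _, _, _, D, hD, hnot, hall⟩ h
    obtain ⟨e, F, h1, h1', h2, h3, h4, h5⟩ := h X D ⟨hD, hnot⟩
    obtain ⟨c, hc, hcn⟩ := hall e F h1 h1' h2 h3 h4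
    exact h5 c hc ⟨h4 c, hcn⟩

/-- **A refutation in the pre-re-type shape still refutes the crux**: if some admissible exceptional datum
`D` is such that EVERY jointly smooth injective admissible one-parameter family through `D` (no end, no
tameness, no immersion required) contains another exceptional member, then `¬ TameCensorship` — tame
families are in particular smooth (`IsTameDataFamily.isSmoothDataFamily`). This is the surviving direction
of the pre-re-type `not_tameCensorship_iff`. -/
theorem not_tameCensorship_of_smooth_witness
    (hw : ∃ (X : Type) (_ : TopologicalSpace X) (_ : ChartedSpace E3 X)
      (_ : IsManifold (modelWithCornersSelf ℝ E3) ((⊤ : ℕ∞) : WithTop ℕ∞) X) (_ : T2Space X)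
      (_ : SecondCountableTopology X) (_ : ConnectedSpace X),
      ∃ D ∈ admissibleVacuumData X, D ∉ tameSet X ∧
        ∀ F : EuclideanSpace ℝ (Fin 1) → InitialDataSet (modelWithCornersSelf ℝ E3) X,
          InitialDataSet.IsSmoothDataFamily 1 F → F 0 = D → Function.Injective F →
          (∀ c, F c ∈ admissibleVacuumData X) →
          ∃ c ≠ 0, F c ∉ tameSet X) : ¬ TameCensorship := by
  obtain ⟨X, _, _, _, _, _, _, D, hD, hnot, hall⟩ := hw
  intro h
  obtain ⟨e, F, h1, -, h2, h3, h4, h5⟩ := (tameCensorship_iff_tame.1 h) X D ⟨hD, hnot⟩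
  obtain ⟨c, hc, hcn⟩ := hall F h1.isSmoothDataFamily h2 h3 h4
  exact h5 c hc ⟨h4 c, hcn⟩

/-- Pre-re-type shape of `¬ TameCensorship` (landed 2026-08-15 against stmt-FinalStateConjecture-10047: an
exceptional admissible datum all of whose SMOOTH injective admissible curves meet the exceptional set
again). Since route rev 15 (T2 re-type) only its `←` direction survives
(`not_tameCensorship_of_smooth_witness`); the name is kept (append-only) as an alias of the re-typed shape
`not_tameCensorship_iff_tame`. -/
@[deprecated not_tameCensorship_iff_tame (since := "2026-08-17")]
alias not_tameCensorship_iff := not_tameCensorship_iff_tame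

/-! ## §3 The existential content of the crux (non-vacuity of the admissible class on `ℝ³` is the
tree's `trivialData_mem_admissibleVacuumData`, `TrivialDataAdmissible.lean`) -/

/-- **Existential content of the crux.** `TameCensorship` implies that SOME admissible datum on
`ℝ³` is tame: it has a maximal vacuum Cauchy development, and all its MGHDs have complete `𝓘⁺`, no
extremal remnant and bounded outer geometry. (Either the Minkowski datum is tame, or the generic
curve through it supplies a tame admissible datum; since rev 15 via the topology-free genericity
`isChristodoulouGeneric_of_tameCensorship`.) -/
theorem exists_mem_tameSet_of_tameCensorship (h : TameCensorship) :
    ∃ D ∈ admissibleVacuumData Minkowski.slice, D ∈ tameSet Minkowski.slice :=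
  exists_of_isChristodoulouGeneric one_ne_zero (isChristodoulouGeneric_of_tameCensorship h Minkowski.slice)
    admissibleVacuumData_slice_nonempty

/-- **Corollary (load-bearing: MGHD theory).** `TameCensorship` implies the existence, for some
admissible datum on `ℝ³`, of a MAXIMAL vacuum Cauchy development with complete future null infinity
(sojourn form). Neither maximality of any development nor the Choquet-Bruhat–Geroch theorem is
proved in the tree, so no proof of the crux can avoid constructing (or importing) an MGHD. -/
theorem exists_isMaximal_of_tameCensorship (h : TameCensorship) :
    ∃ D ∈ admissibleVacuumData Minkowski.slice, ∃ 𝒟 : VacuumCauchyDevelopment D,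
      𝒟.IsMaximal ∧ _root_.Summit.FinalStateConjecture.HasCompleteNullInfinity 𝒟.toCauchyDevelopment := by
  obtain ⟨D, hD, ⟨𝒟, hmax⟩, hall⟩ := exists_mem_tameSet_of_tameCensorship h
  exact ⟨D, hD, 𝒟, hmax, (hall 𝒟 hmax).1⟩

end Summit.FinalStateConjecture.FinalStateConjecture.Theorems.TameCensorship.Negative

end
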